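import Literature.Computability.Complexity.GF2Circuits
import Literature.Computability.MetaComplexity.SubcubeExtension
import Literature.Computability.Complexity.CircuitClassesProofs
import HarnessLib

/-!
# Worst-case to mild average-case hardness: the self-correcting reduction as a circuit (Arora–Barak 2009, Thm. 19.21)

The first link of hardness amplification inside `E` (Babai–Fortnow–Nisan–Wigderson 1993, §4;
Arora–Barak 2009, Thm. 19.21 "worst-case hardness to mild hardness"), as ONE circuit-size theorem
over the tree's straight-line `B₂`-circuits (`CktSize`): a circuit that errs on few inputs of the
"hard function" `g` built from a Boolean `f` on `({0,1}^η)ᵏ` — the coordinates of the low-degree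
extension `P` of `f` over `GF(2^{M+1})` (`MetaComplexity/SubcubeExtension.lean`, field coordinates
from `GF2Circuits.lean`) — yields a circuit computing `f` EVERYWHERE, of size polynomial in the
parameters times `|C|`.

* `cubePt`, `ext f` — the subcube `{0,1}^η ↪ GF(2^{M+1})` (low coordinates) and the extension
  (`ext_cube`); `hardFn f` — the hard function `g(z, r) = (P(z))_l` if `r = e_l` (one-hot), else `0`
  (a bit-projection of the Reed–Muller codeword; Arora–Barak concatenate with Walsh–Hadamard, which
  only the strong (list-decoding) regime needs), `hardFn_apply`;
* `wrong C f`, `badSet C f`, `card_badSet_le` (`#bad ≤ (M+1) #wrong`), `cktSize_coord` (the `M + 1`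
  hardwired copies of `C` answer the coordinates of `P(z)` off the bad set);
* the trial circuit (`point`, `cktSize_point`: query points `z + τ_a y` are `GF(2)`-linear in the
  input bits; `cktSize_answers`; `cktSize_combine`: `Σ_a λ_a v_a` is linear in the answer bits;
  `trial`, `cktSize_trial`, `trialSize`) and its value `trial_eq`: at a cube point, if no query point
  is bad, the trial returns `f` (the interpolation identity `lowDegExt_eq_sum_nodes`);
* `corr`, `cktSize_corr`, `err_corr_le` — the corrector in the shape of `recMaj`
  (`CircuitClassesProofs.lean`) errs on `≤ 1/3` of the directions at every cube point once
  `3 (D+1)(M+1) #wrong ≤ 2^{k(M+1)}` (each query point is uniform: `card_filter_exists_line_mem`; the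
  bits of a direction are in bijection with the directions since the field has characteristic `2`);
* **`cktSize_of_mildCircuit`** — amplification by recursive majority, union bound over the `2^{kη}`
  cube points, hardwiring (Adleman's argument, reused from `CircuitClassesProofs.lean`):
  `f ∘ rows` has a `B₂`-circuit of size `27 (2kη + 2)² (trialSize k M D |C| + 3)`.

The language-level transfer (worst-case `2^{εn}` a.e. ⟹ mild average-case hardness a.e. of an
explicit language) is `MildHardLanguage.lean`.

## References

* S. Arora, B. Barak, *Computational Complexity: A Modern Approach*, CUP 2009, §19.4.2 (Reed–Muller
  local decoder: random line, `d + 1` queries, interpolation), §19.4.3 (concatenation), Thm. 19.21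
  [AroraBarakCC2009] (held text, PDF pp. 455–459, checked).
* L. Babai, L. Fortnow, N. Nisan, A. Wigderson, *BPP has subexponential time simulations unless
  EXPTIME has publishable proofs*, Comput. Complexity 3 (1993) 307–318, §4 (random self-reducibility
  of the low-degree extension).
* H. Vollmer, *Introduction to Circuit Complexity*, Springer 1999, §1.2 [Vollmer1999].

## Design notes

* The corrector queries `D + 1 = k(2^η - 1) + 1` points on ONE random line and interpolates with
  fixed Lagrange weights; it tolerates only a `1/(3(D+1)(M+1)2^{M+1})` error RATE ("very mild"
  hardness), which is what the first step of Impagliazzo–Wigderson's chain consumes; Arora–Barak's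
  constant `0.99` would need Berlekamp–Welch decoding on the line.
* All field arithmetic in the corrector is `GF(2)`-linear in coordinates (fixed nodes and weights),
  so the whole trial is XOR circuits around copies of `C` — no multiplication circuit is built; and
  `b`-bit strings are in bijection with field elements, so uniform coin bits ARE a uniform direction
  (a prime field would lose a factor `2` per block here).
-/

noncomputable section

namespace Literature.Computability.Complexity

open Finset MetaComplexity Literature.InformationTheory.Coding

namespace SelfCorrect

variable {k η M : ℕ}

/-- `GF(2^{M+1})` is finite (a finite free module over `𝔽₂`). [folklore] -/
instance finiteGF2 (M : ℕ) : Finite (GF2 M) :=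
  have : Module.Finite (ZMod 2) (GF2 M) := Module.Finite.of_basis (GF2.basis M)
  Module.finite_of_finite (ZMod 2)

/-- A (noncomputable) enumeration of `GF(2^{M+1})`. [folklore] -/
instance fintypeGF2 (M : ℕ) : Fintype (GF2 M) := Fintype.ofFinite _

/-- `|GF(2^{M+1})| = 2^{M+1}`. [folklore] -/
theorem card_GF2 (M : ℕ) : Fintype.card (GF2 M) = 2 ^ (M + 1) := by
  rw [Module.card_eq_pow_finrank (K := ZMod 2) (V := GF2 M), ZMod.card,
    Module.finrank_eq_card_basis (GF2.basis M), Fintype.card_fin]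

/-! ### The subcube `{0,1}^η ⊆ GF(2^{M+1})` and the extension of a Boolean function -/

/-- Padding `η` bits to `M + 1` coordinates with zeros. [folklore] -/
def padBits (η M : ℕ) (b : Fin η → Bool) : Fin (M + 1) → Bool :=
  fun l => if h : (l : ℕ) < η then b ⟨l, h⟩ else false

/-- **The cube point** of `η` bits: the field element with these low coordinates (the subset
`H ⊆ F` of the Reed–Muller encoding, Arora–Barak 2009, §19.4.2; here `H = {0,1}^η` sitting in the
first `η` coordinates of the power basis). [cite: AroraBarakCC2009, §19.4.2] -/
def cubePt (η M : ℕ) (b : Fin η → Bool) : GF2 M := decF M (padBits η M b)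

/-- Padding is injective when `η ≤ M + 1`. [folklore] -/
theorem padBits_injective (hη : η ≤ M + 1) : Function.Injective (padBits η M) := by
  intro b b' h
  funext j
  have := congrFun h ⟨j, lt_of_lt_of_le j.isLt hη⟩
  simpa [padBits, j.isLt] using this

/-- Cube points are distinct when `η ≤ M + 1`. [folklore] -/
theorem cubePt_injective (hη : η ≤ M + 1) : Function.Injective (cubePt η M) := fun b b' h =>
  padBits_injective hη (by simpa [cubePt] using congrArg (encF M) h)

/-- Coordinates of a cube point: the padded bits. [folklore] -/
@[simp] theorem encF_cubePt (b : Fin η → Bool) : encF M (cubePt η M b) = padBits η M b := by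
  simp [cubePt]

/-- A bit as a field element. [folklore] -/
def bitF (M : ℕ) (b : Bool) : GF2 M := if b then 1 else 0

/-- **The extension of a Boolean function on the cube `({0,1}^η)ᵏ`** to `GF(2^{M+1})ᵏ`.
[cite: AroraBarakCC2009, §19.4.2] -/
def ext (f : (Fin k → Fin η → Bool) → Bool) : (Fin k → GF2 M) → GF2 M :=
  lowDegExt (cubePt η M) fun a => bitF M (f a)

/-- The extension takes the value `[f a]` at the cube point `a`. [cite: AroraBarakCC2009, §19.4.2] -/
theorem ext_cube (hη : η ≤ M + 1) (f : (Fin k → Fin η → Bool) → Bool) (a : Fin k → Fin η → Bool) :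
    ext f (fun i => cubePt η M (a i)) = bitF M (f a) :=
  lowDegExt_cube _ (cubePt_injective hη) _ a

/-- Coordinates of `1`: the indicator of position `0`. [folklore] -/
theorem encF_one (l : Fin (M + 1)) : encF M 1 l = decide ((l : ℕ) = 0) := by
  unfold encF
  rw [show (1 : GF2 M) = AdjoinRoot.mk (canonIrred M) 1 from (map_one _).symm, GF2.basis_repr_mk]
  have hmod : (1 : Polynomial (ZMod 2)) %ₘ canonIrred M = 1 := by
    refine (Polynomial.modByMonic_eq_self_iff (monic_canonIrred M)).2 ?_
    rw [Polynomial.degree_one, Polynomial.degree_eq_natDegree (monic_canonIrred M).ne_zero, natDegree_canonIrred]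
    exact_mod_cast Nat.succ_pos M
  rw [hmod, Polynomial.coeff_one]
  by_cases h : (l : ℕ) = 0 <;> simp [h, zBit] <;> rfl

/-- Coordinates of `0`. [folklore] -/
theorem encF_zero (l : Fin (M + 1)) : encF M 0 l = false := by simp [encF, zBit]; rfl

/-- The test `[u = 1]` on coordinates. [folklore] -/
theorem eq_one_iff_encF (u : GF2 M) : u = 1 ↔ ∀ l : Fin (M + 1), encF M u l = decide ((l : ℕ) = 0) := by
  constructor
  · rintro rfl l; exact encF_one l
  · intro h
    apply encF_injective M
    funext l
    rw [h l, encF_one]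

/-- `[bitF b = 1] = b`. [folklore] -/
theorem bitF_eq_one_iff (b : Bool) : bitF M b = 1 ↔ b = true := by
  cases b <;> simp [bitF]

/-! ### The hard function: coordinates of the extension, selected by a one-hot index -/

/-- Index type of the point part of the input: `k` blocks of `M + 1` coordinates. [folklore] -/
abbrev ZIdx (k M : ℕ) : Type := Fin k × Fin (M + 1)

/-- The point read off the input bits. [folklore] -/
def zOf (w : ZIdx k M ⊕ Fin (M + 1) → Bool) : Fin k → GF2 M := fun i => decF M fun l => w (.inl (i, l))

/-- The bits of a point. [folklore] -/
def encZ (z : Fin k → GF2 M) : ZIdx k M → Bool := fun p => encF M (z p.1) p.2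

/-- The one-hot indicator of a coordinate. [folklore] -/
def indic (l : Fin (M + 1)) : Fin (M + 1) → Bool := fun l' => decide (l' = l)

/-- Indicators are injective. [folklore] -/
theorem indic_injective : Function.Injective (indic (M := M)) := fun l l' h => by
  have := congrFun h l
  simpa [indic] using this.symm

/-- Reading back a point. [folklore] -/
@[simp] theorem zOf_elim (z : Fin k → GF2 M) (r : Fin (M + 1) → Bool) : zOf (Sum.elim (encZ z) r) = z := by
  funext i
  simp only [zOf, Sum.elim_inl, encZ]
  exact decF_encF M (z i)

/-- **The hard function `g`** of the reduction on `(z, r) ∈ GF(2^{M+1})ᵏ × {0,1}^{M+1}` (in bits):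
the `l`-th coordinate of the extension `P(z)` if `r` is the indicator of `l`, and `0` otherwise
(a bit-projection of the Reed–Muller codeword; Arora–Barak 2009, §19.4 encode the field elements by
Walsh–Hadamard instead, which the mild regime does not need). [cite: AroraBarakCC2009, Thm. 19.21 (proof)] -/
def hardFn (f : (Fin k → Fin η → Bool) → Bool) (w : ZIdx k M ⊕ Fin (M + 1) → Bool) : Bool :=
  open scoped Classical in
  if h : ∃ l : Fin (M + 1), (fun l' => w (.inr l')) = indic l then encF M (ext f (zOf w)) h.choose else false

/-- **Value of the hard function on an honest input.** [folklore] -/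
theorem hardFn_apply (f : (Fin k → Fin η → Bool) → Bool) (z : Fin k → GF2 M) (l : Fin (M + 1)) :
    hardFn f (Sum.elim (encZ z) (indic l)) = encF M (ext f z) l := by
  classical
  unfold hardFn
  have hex : ∃ l₀ : Fin (M + 1), (fun l' => Sum.elim (encZ z) (indic l) (Sum.inr l')) = indic l₀ := ⟨l, rfl⟩
  rw [dif_pos hex, zOf_elim]
  congr 1
  exact indic_injective (hex.choose_spec.symm.trans rfl)

/-! ### The bad set of a circuit for `g` -/

variable (C : Circuit (ZIdx k M ⊕ Fin (M + 1))) (f : (Fin k → Fin η → Bool) → Bool)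

/-- The inputs on which `C` errs. [folklore] -/
def wrong : Finset (ZIdx k M ⊕ Fin (M + 1) → Bool) := univ.filter fun w => C.eval w ≠ hardFn f w

/-- **The bad points**: those `z` some coordinate of whose extension value `C` gets wrong.
[cite: AroraBarakCC2009, §19.4.2] -/
def badSet : Finset (Fin k → GF2 M) :=
  univ.filter fun z => ∃ l, C.eval (Sum.elim (encZ z) (indic l)) ≠ encF M (ext f z) l

/-- **Few bad points**: `#bad ≤ (M + 1) · #wrong`. [folklore] -/
theorem card_badSet_le : #(badSet C f) ≤ (M + 1) * #(wrong C f) := by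
  classical
  have hcover : badSet C f ⊆ (univ : Finset (Fin (M + 1))).biUnion fun l =>
      univ.filter fun z : Fin k → GF2 M => C.eval (Sum.elim (encZ z) (indic l)) ≠ encF M (ext f z) l := by
    intro z hz
    obtain ⟨l, hl⟩ := (mem_filter.1 hz).2
    exact mem_biUnion.2 ⟨l, mem_univ _, mem_filter.2 ⟨mem_univ _, hl⟩⟩
  refine (card_le_card hcover).trans (card_biUnion_le.trans ?_)
  have hl : ∀ l : Fin (M + 1),
      #(univ.filter fun z : Fin k → GF2 M => C.eval (Sum.elim (encZ z) (indic l)) ≠ encF M (ext f z) l) ≤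
        #(wrong C f) := by
    intro l
    refine card_le_card_of_injOn (fun z => Sum.elim (encZ z) (indic l)) (fun z hz => ?_) ?_
    · rw [mem_coe, mem_filter] at hz
      rw [mem_coe, wrong, mem_filter]
      exact ⟨mem_univ _, by rw [hardFn_apply]; exact hz.2⟩
    · intro z _ z' _ h
      have := congrArg zOf h
      simpa using this
  calc ∑ l : Fin (M + 1), #(univ.filter fun z : Fin k → GF2 M =>
        C.eval (Sum.elim (encZ z) (indic l)) ≠ encF M (ext f z) l)
      ≤ ∑ _l : Fin (M + 1), #(wrong C f) := sum_le_sum fun l _ => hl l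
    _ = (M + 1) * #(wrong C f) := by simp

/-- Off the bad set, the `M + 1` hardwired copies of `C` return the coordinates of `P(z)`. [folklore] -/
theorem eval_indic_of_not_mem {z : Fin k → GF2 M} (hz : z ∉ badSet C f) (l : Fin (M + 1)) :
    C.eval (Sum.elim (encZ z) (indic l)) = encF M (ext f z) l := by
  by_contra h
  exact hz (mem_filter.2 ⟨mem_univ _, l, h⟩)

/-- **The coordinate circuit `C₁`**: `z ↦ (C(z, e_l))_l`, `M + 1` hardwired copies of `C`.
[cite: AroraBarakCC2009, §19.4.3 (concatenation: answering the outer decoder's queries)] -/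
theorem cktSize_coord (hC : C.IsOver B2) :
    CktSize B2 (fun (zb : ZIdx k M → Bool) (l : Fin (M + 1)) => C.eval (Sum.elim zb (indic l)))
      ((M + 1) * (C.size + 2)) := by
  have h := CktSize.pi_const (κ := Fin (M + 1)) fun l => (C.cktSize_eval hC).hardwire (indic l)
  rwa [Fintype.card_fin] at h

/-! ### Small circuit helpers -/

/-- Bundling `m` multi-output programs on the same inputs: sizes add. [cite: Vollmer1999, §1.2] -/
theorem _root_.Literature.Computability.Complexity.CktSize.piProd {ι κ : Type*} {B : Set GateFn} {m : ℕ}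
    {g : (ι → Bool) → Fin m → κ → Bool} {s : Fin m → ℕ} (h : ∀ a, CktSize B (fun x => g x a) (s a)) :
    CktSize B (fun x (p : Fin m × κ) => g x p.1 p.2) (∑ a, s a) := by
  induction m with
  | zero =>
    rw [Finset.univ_eq_empty, Finset.sum_empty]
    haveI : IsEmpty (Fin 0 × κ) := by infer_instance
    exact CktSize.of_isEmpty B _
  | succ m ih =>
    have h1 := ih (g := fun x a => g x a.castSucc) (s := fun a => s a.castSucc) fun a => h a.castSucc
    have h2 := h1.pair (h (Fin.last m))
    rw [Fin.sum_univ_castSucc]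
    refine (h2.outMap fun p : Fin (m + 1) × κ =>
      if hp : (p.1 : ℕ) < m then Sum.inl (⟨p.1, hp⟩, p.2) else Sum.inr p.2).congr fun x p => ?_
    by_cases hp : (p.1 : ℕ) < m
    · simp only [hp, ↓reduceDIte, Sum.elim_inl]
      rfl
    · have hlast : p.1 = Fin.last m := Fin.eq_last_of_not_lt hp
      rw [dif_neg hp, Sum.elim_inr, hlast]

/-- The conjunction (iterated AND) of `m` bits, as a chain. [folklore] -/
def andFin : (m : ℕ) → (Fin m → Bool) → Bool
  | 0, _ => true
  | m + 1, z => andFin m (fun j => z j.castSucc) && z (Fin.last m)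

/-- `andFin` is the `∀`. [folklore] -/
theorem andFin_eq_decide : ∀ (m : ℕ) (z : Fin m → Bool), andFin m z = decide (∀ j, z j = true)
  | 0, z => by simp [andFin]
  | m + 1, z => by
    rw [andFin, andFin_eq_decide m]
    rw [Bool.eq_iff_iff]
    simp only [Bool.and_eq_true, decide_eq_true_eq, Fin.forall_fin_succ']

/-- An `m`-fold conjunction costs `m + 1` gates over `B₂`. [cite: Vollmer1999, §1.2] -/
theorem cktSize_andFin : ∀ m : ℕ, CktSize B2 (fun (z : Fin m → Bool) (_ : Unit) => andFin m z) (m + 1)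
  | 0 => (cktSize_const (Fin 0) true).congr fun z u => rfl
  | m + 1 => by
    have hA : CktSize B2 (fun (z : Fin (m + 1) → Bool) =>
        Sum.elim (fun (_ : Unit) => andFin m fun j => z j.castSucc) (fun (_ : Unit) => z (Fin.last m))) ((m + 1) + 0) :=
      ((cktSize_andFin m).rewire Fin.castSucc).pair ((CktSize.proj B2 fun _ : Unit => Fin.last m).congr fun _ _ => rfl)
    have hB := cktSize_bin (ι := Unit ⊕ Unit) (· && ·) (.inl ()) (.inr ())
    exact ((hA.comp hB).of_le (by omega)).congr fun z u => rfl

/-- **Testing a bit vector against a constant** costs `2m + 1` gates: XOR with the complemented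
constant, then an AND chain. [folklore] -/
theorem cktSize_eqConst {m : ℕ} (c : Fin m → Bool) :
    CktSize B2 (fun (z : Fin m → Bool) (_ : Unit) => decide (z = c)) (m * 1 + (m + 1)) := by
  have h1 := CktSize.pi_const (κ := Fin m) fun j => cktSize_xorConst (ι := Fin m) j (!c j)
  rw [Fintype.card_fin] at h1
  refine (h1.comp (cktSize_andFin m)).congr fun z _ => ?_
  rw [andFin_eq_decide]
  apply Bool.decide_congr
  constructor
  · intro h; funext j; have := h j; revert this; cases z j <;> cases c j <;> simp
  · rintro rfl j; cases z j <;> rfl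

/-! ### Coordinates of affine combinations are linear forms in the input bits -/

/-- The matrix of a `GF(2)`-linear map of the field in the power basis. [folklore] -/
def matOf (φ : GF2 M →ₗ[ZMod 2] GF2 M) (l l' : Fin (M + 1)) : ZMod 2 := (GF2.basis M).repr (φ (GF2.basis M l')) l

/-- Coordinates of `u + c·y` as a linear form in the coordinates of `u` and `y`. [folklore] -/
theorem encF_add_mul (c u y : GF2 M) (l : Fin (M + 1)) :
    encF M (u + c * y) l =
      zBit (bitZ (encF M u l) + ∑ l', matOf (LinearMap.mulLeft (ZMod 2) c) l l' * bitZ (encF M y l')) := by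
  rw [encF_add, ← LinearMap.mulLeft_apply (R := ZMod 2) c y, encF_linearMap]
  simp only [encF, bitZ_zBit, ← zBit_add, matOf]

/-! ### The trial circuit: interpolation along a line through `z` in a direction `y` -/

section Trial

variable {D : ℕ} (τ : Fin (D + 1) → GF2 M)

/-- The query point `z + τ_a y` of node `a`. [cite: AroraBarakCC2009, §19.4.2] -/
def point (a : Fin (D + 1)) (z y : Fin k → GF2 M) : Fin k → GF2 M := fun i => z i + τ a * y i

/-- The point part of the trial circuit's input. [folklore] -/
def zIn (w : ZIdx k M ⊕ ZIdx k M → Bool) : Fin k → GF2 M := fun i => decF M fun l => w (.inl (i, l))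
/-- The direction part of the trial circuit's input. [folklore] -/
def yIn (w : ZIdx k M ⊕ ZIdx k M → Bool) : Fin k → GF2 M := fun i => decF M fun l => w (.inr (i, l))

/-- Reading back the point part. [folklore] -/
@[simp] theorem zIn_elim (z y : Fin k → GF2 M) : zIn (Sum.elim (encZ z) (encZ y)) = z := by
  funext i; simp only [zIn, Sum.elim_inl, encZ]; exact decF_encF M (z i)

/-- Reading back the direction part. [folklore] -/
@[simp] theorem yIn_elim (z y : Fin k → GF2 M) : yIn (Sum.elim (encZ z) (encZ y)) = y := by
  funext i; simp only [yIn, Sum.elim_inr, encZ]; exact decF_encF M (y i)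

/-- The coefficient vector of the linear form giving coordinate `(i, l)` of the query point of node `a`. [folklore] -/
def pointCoeff (a : Fin (D + 1)) (p : ZIdx k M) : ZIdx k M ⊕ ZIdx k M → ZMod 2
  | .inl q => if q = p then 1 else 0
  | .inr q => if q.1 = p.1 then matOf (LinearMap.mulLeft (ZMod 2) (τ a)) p.2 q.2 else 0

/-- **The query points are linear in the input bits**, hence XOR circuits of size
`k(M+1) · (2k(M+1) + 1)` per node. [cite: AroraBarakCC2009, §19.4.2] -/
theorem cktSize_point (a : Fin (D + 1)) :
    CktSize B2 (fun (w : ZIdx k M ⊕ ZIdx k M → Bool) (p : ZIdx k M) => encZ (point τ a (zIn w) (yIn w)) p)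
      (Fintype.card (ZIdx k M) * (Fintype.card (ZIdx k M ⊕ ZIdx k M) + 1)) := by
  classical
  refine (cktSize_linearMap (pointCoeff τ a)).congr fun w p => ?_
  obtain ⟨i, l⟩ := p
  rw [encZ, point, encF_add_mul]
  congr 1
  rw [Fintype.sum_sum_type]
  congr 1
  · -- the `z` part: the single coordinate `(i, l)`
    rw [Fintype.sum_eq_single (i, l) (fun q hq => by rw [pointCoeff, if_neg hq, zero_mul])]
    rw [pointCoeff, if_pos rfl, one_mul, zIn, encF_decF]
  · -- the `y` part: block `i` through the multiplication matrix
    rw [Fintype.sum_prod_type, Fintype.sum_eq_single i (fun i' hi' => Finset.sum_eq_zero fun l' _ => by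
      rw [pointCoeff, if_neg (by exact hi'), zero_mul])]
    refine Finset.sum_congr rfl fun l' _ => ?_
    rw [pointCoeff, if_pos rfl, yIn, encF_decF]

/-- **The answers**: the coordinate circuit on every query point; off the bad set these are the
coordinates of `P(z + τ_a y)`. [cite: AroraBarakCC2009, §19.4.2] -/
theorem cktSize_answers (hC : C.IsOver B2) :
    CktSize B2 (fun (w : ZIdx k M ⊕ ZIdx k M → Bool) (p : Fin (D + 1) × Fin (M + 1)) =>
        C.eval (Sum.elim (encZ (point τ p.1 (zIn w) (yIn w))) (indic p.2)))
      ((D + 1) * (Fintype.card (ZIdx k M) * (Fintype.card (ZIdx k M ⊕ ZIdx k M) + 1) + (M + 1) * (C.size + 2))) := by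
  have h : ∀ a : Fin (D + 1), CktSize B2 (fun (w : ZIdx k M ⊕ ZIdx k M → Bool) (l : Fin (M + 1)) =>
      C.eval (Sum.elim (encZ (point τ a (zIn w) (yIn w))) (indic l)))
      (Fintype.card (ZIdx k M) * (Fintype.card (ZIdx k M ⊕ ZIdx k M) + 1) + (M + 1) * (C.size + 2)) := fun a =>
    (cktSize_point τ a).comp (cktSize_coord C hC)
  have := CktSize.piProd h
  simpa using this

/-- The Lagrange weights `λ_a = L_a(0)` of the nodes. [cite: AroraBarakCC2009, §19.4.2] -/
def weight (a : Fin (D + 1)) : GF2 M := (Lagrange.basis univ τ a).eval 0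

/-- The field elements read off an answer array. [folklore] -/
def ansVal (c : Fin (D + 1) × Fin (M + 1) → Bool) (a : Fin (D + 1)) : GF2 M := decF M fun l => c (a, l)

/-- **The interpolated value `Σ_a λ_a v_a` is linear in the answer bits.** [folklore] -/
theorem cktSize_combine :
    CktSize B2 (fun (c : Fin (D + 1) × Fin (M + 1) → Bool) (l : Fin (M + 1)) =>
        encF M (∑ a, weight τ a * ansVal c a) l)
      ((M + 1) * (Fintype.card (Fin (D + 1) × Fin (M + 1)) + 1)) := by
  classical
  have h := cktSize_linearMap (ι := Fin (D + 1) × Fin (M + 1)) (κ := Fin (M + 1))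
    fun l q => matOf (LinearMap.mulLeft (ZMod 2) (weight τ q.1)) l q.2
  rw [Fintype.card_fin] at h
  refine h.congr fun c l => ?_
  -- coordinates of a sum are sums of coordinates
  unfold encF
  rw [map_sum, Finsupp.coe_finsetSum, Finset.sum_apply, Fintype.sum_prod_type]
  congr 1
  refine Finset.sum_congr rfl fun a _ => ?_
  have := encF_linearMap M (LinearMap.mulLeft (ZMod 2) (weight τ a)) (ansVal c a) l
  rw [LinearMap.mulLeft_apply] at this
  unfold encF at this
  rw [← bitZ_zBit ((GF2.basis M).repr (weight τ a * ansVal c a) l), this, bitZ_zBit]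
  refine Finset.sum_congr rfl fun l' _ => ?_
  have e := congrFun (encF_decF M (fun l => c (a, l))) l'
  simp only [encF] at e
  rw [matOf, ansVal, e]

/-- **The trial circuit** `T(z, y) = [Σ_a λ_a C₁(z + τ_a y) = 1]`. [cite: AroraBarakCC2009, §19.4.2] -/
def trial (w : ZIdx k M ⊕ ZIdx k M → Bool) : Bool :=
  decide ((fun l => encF M (∑ a, weight τ a *
      ansVal (fun p : Fin (D + 1) × Fin (M + 1) => C.eval (Sum.elim (encZ (point τ p.1 (zIn w) (yIn w))) (indic p.2))) a) l) =
    fun l : Fin (M + 1) => decide ((l : ℕ) = 0))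

/-- The size of the trial circuit. [folklore] -/
def trialSize (k M D s : ℕ) : ℕ :=
  (D + 1) * (k * (M + 1) * (2 * (k * (M + 1)) + 1) + (M + 1) * (s + 2)) +
    (M + 1) * ((D + 1) * (M + 1) + 1) + ((M + 1) * 1 + (M + 1 + 1))

/-- **The trial circuit is small**: `trialSize k M D |C|` gates. [cite: AroraBarakCC2009, §19.4.2] -/
theorem cktSize_trial (hC : C.IsOver B2) :
    CktSize B2 (fun (w : ZIdx k M ⊕ ZIdx k M → Bool) (_ : Unit) => trial C τ w) (trialSize k M D C.size) := by
  have h := ((cktSize_answers C τ hC).comp (cktSize_combine τ)).comp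
    (cktSize_eqConst (m := M + 1) fun l => decide ((l : ℕ) = 0))
  refine (h.of_le (le_of_eq ?_)).congr fun w _ => rfl
  simp only [trialSize, Fintype.card_prod, Fintype.card_fin, Fintype.card_sum]
  ring

/-- **Value of the trial circuit**: at a cube point `z = a₀`, if no query point is bad, the trial
returns `f a₀` (all answers are correct, the interpolation identity gives `P(z) = [f a₀]`).
[cite: AroraBarakCC2009, §19.4.2] -/
theorem trial_eq (hη : η ≤ M + 1) (hD : k * (2 ^ η - 1) ≤ D) (hτ : Function.Injective τ)
    (a₀ : Fin k → Fin η → Bool) (y : Fin k → GF2 M)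
    (hgood : ∀ a, point τ a (fun i => cubePt η M (a₀ i)) y ∉ badSet C f) :
    trial C τ (Sum.elim (encZ fun i => cubePt η M (a₀ i)) (encZ y)) = f a₀ := by
  set z : Fin k → GF2 M := fun i => cubePt η M (a₀ i) with hz
  have hans : ∀ a, ansVal (fun p : Fin (D + 1) × Fin (M + 1) =>
      C.eval (Sum.elim (encZ (point τ p.1 (zIn (Sum.elim (encZ z) (encZ y))) (yIn (Sum.elim (encZ z) (encZ y)))))
        (indic p.2))) a = ext f (point τ a z y) := by
    intro a
    unfold ansVal
    rw [zIn_elim, yIn_elim]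
    conv_rhs => rw [← decF_encF M (ext f (point τ a z y))]
    congr 1
    funext l
    exact eval_indic_of_not_mem C f (hgood a) l
  have hsum : ∑ a, weight τ a * ext f (point τ a z y) = ext f z := by
    have hcard : k * (Fintype.card (Fin η → Bool) - 1) ≤ D := by simpa [Fintype.card_fun] using hD
    rw [ext, lowDegExt_eq_sum_nodes _ (cubePt_injective hη) _ z y hcard τ hτ]
    rfl
  unfold trial
  simp only [hans, hsum]
  rw [hz, ext_cube hη]
  have key : ((fun l => encF M (bitF M (f a₀)) l) = fun l : Fin (M + 1) => decide ((l : ℕ) = 0)) ↔ f a₀ = true := by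
    rw [← bitF_eq_one_iff (M := M), eq_one_iff_encF]
    exact ⟨fun h l => congrFun h l, fun h => funext h⟩
  rw [Bool.decide_congr key, Bool.decide_eq_true]

end Trial

/-! ### Amplification, union bound, hardwiring: a circuit for `f` on the whole cube -/

section Assembly

variable {D : ℕ} (τ : Fin (D + 1) → GF2 M)

/-- Reading the cube point off `kη` input bits (row-major blocks of `η` bits). [folklore] -/
def rows (k η : ℕ) (u : Fin (k * η) → Bool) : Fin k → Fin η → Bool := fun i j => u (finProdFinEquiv (i, j))

/-- The padded point bits of an input. [folklore] -/
def padZ (u : Fin (k * η) → Bool) : ZIdx k M → Bool := fun p => padBits η M (rows k η u p.1) p.2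

/-- The padded point bits are the coordinates of the cube point. [folklore] -/
theorem padZ_eq (u : Fin (k * η) → Bool) : padZ (M := M) u = encZ fun i => cubePt η M (rows k η u i) := by
  funext p; simp [padZ, encZ]

/-- **The randomized corrector** as a verdict function of (input bits, direction bits), the shape
of `recMaj` (`CircuitClassesProofs.lean`). [cite: AroraBarakCC2009, §19.4.2] -/
def corr (u : Fin (k * η) → Bool) (v : ZIdx k M → Bool) : Bool := trial C τ (Sum.elim (padZ u) v)

/-- The embedding of the corrector's inputs into the trial circuit's inputs: pad with a constant `0`. [folklore] -/
theorem cktSize_corr (hC : C.IsOver B2) :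
    CktSize B2 (fun (w : Fin (k * η) ⊕ ZIdx k M → Bool) (_ : Unit) =>
      corr C τ (fun a => w (.inl a)) (fun b => w (.inr b))) (0 + 1 + trialSize k M D C.size) := by
  have h1 : CktSize B2 (fun (w : Fin (k * η) ⊕ ZIdx k M → Bool) =>
      Sum.elim w (fun (_ : Unit) => false)) (0 + 1) :=
    (CktSize.id B2).pair (cktSize_const _ false)
  have h2 := h1.outMap (κ' := ZIdx k M ⊕ ZIdx k M) fun q => match q with
    | .inl p => if h : (p.2 : ℕ) < η then .inl (.inl (finProdFinEquiv (p.1, ⟨p.2, h⟩))) else .inr ()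
    | .inr p => .inl (.inr p)
  refine (h2.comp (cktSize_trial C τ hC)).congr fun w _ => ?_
  unfold corr
  congr 1
  funext q
  cases q with
  | inl p =>
    simp only [Sum.elim_inl, padZ, padBits, rows]
    by_cases h : (p.2 : ℕ) < η
    · simp [h]
    · simp [h]
  | inr p => rfl

/-- **The corrector is right for two thirds of the directions**, at every cube point, provided
`3 (D+1)(M+1) · #wrong ≤ 2^{k(M+1)}` (each of the `D + 1` query points is uniform, and only the
`≤ (M+1) · #wrong` bad points can spoil an answer). [cite: AroraBarakCC2009, §19.4.2] -/
theorem err_corr_le (hη : η ≤ M + 1) (hD : k * (2 ^ η - 1) ≤ D) (hτ : Function.Injective τ) (hτ0 : ∀ a, τ a ≠ 0)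
    (hwrong : 3 * ((D + 1) * ((M + 1) * #(wrong C f))) ≤ 2 ^ (k * (M + 1))) (u : Fin (k * η) → Bool) :
    err (corr C τ) 0 u (f (rows k η u)) ≤ 1 / 3 := by
  classical
  set z : Fin k → GF2 M := fun i => cubePt η M (rows k η u i) with hz
  unfold err
  rw [card_wrongSet_zero, card_coins_zero, Fintype.card_prod, Fintype.card_fin, Fintype.card_fin]
  -- the wrong directions decode into directions with a bad query point
  have hle : #{v : ZIdx k M → Bool | corr C τ u v ≠ f (rows k η u)} ≤
      #{y : Fin k → GF2 M | ∃ a, (fun i => z i + τ a * y i) ∈ badSet C f} := by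
    refine card_le_card_of_injOn (fun v i => decF M fun l => v (i, l)) (fun v hv => ?_) ?_
    · rw [mem_coe, mem_filter] at hv ⊢
      refine ⟨mem_univ _, ?_⟩
      by_contra hgood
      push Not at hgood
      apply hv.2
      have hv' : v = encZ (fun i => decF M fun l => v (i, l)) := by
        funext p; simp [encZ]
      rw [corr, padZ_eq, hv']
      exact trial_eq C f τ hη hD hτ (rows k η u) _ fun a => hgood a
    · intro v _ v' _ h
      funext p
      have := congrArg (fun y : Fin k → GF2 M => encF M (y p.1) p.2) h
      simpa using this
  have hbad := card_filter_exists_line_mem z τ hτ0 (badSet C f)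
  have hB := card_badSet_le C f
  rw [div_le_iff₀ (by positivity)]
  have h1 : (#{v : ZIdx k M → Bool | corr C τ u v ≠ f (rows k η u)} : ℝ) * 3 ≤ 2 ^ (k * (M + 1)) := by
    have : #{v : ZIdx k M → Bool | corr C τ u v ≠ f (rows k η u)} * 3 ≤ 2 ^ (k * (M + 1)) := by
      calc _ ≤ (D + 1) * #(badSet C f) * 3 := Nat.mul_le_mul_right _ (hle.trans hbad)
        _ ≤ (D + 1) * ((M + 1) * #(wrong C f)) * 3 := by gcongr
        _ ≤ 2 ^ (k * (M + 1)) := by linarith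
    exact_mod_cast this
  push_cast
  linarith

/-- **Worst-case hardness of `f` from a mildly erring circuit for `g`** (the reduction of
Babai–Fortnow–Nisan–Wigderson 1993 / Arora–Barak 2009, Thm. 19.21, in the very mild regime): if
a `B₂`-circuit `C` computes the hard function `g` of `f` on all but `#wrong` inputs with
`3 (D+1)(M+1) · #wrong ≤ 2^{k(M+1)}` (`η ≤ M + 1`, `D ≥ k(2^η - 1)`, `D + 2 ≤ 2^{M+1}` nodes), then
`f` itself — on all of `{0,1}^{kη}` — has a `B₂`-circuit of size
`27 (2kη + 2)² · (trialSize k M D |C| + 3)`: self-correct along a random line (error `≤ 1/3` at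
every point), amplify by recursive majority, fix the directions by the union bound over the `2^{kη}`
inputs (Adleman), hardwire them. [cite: AroraBarakCC2009, Thm. 19.21] -/
theorem cktSize_of_mildCircuit (hη : η ≤ M + 1) (hD : k * (2 ^ η - 1) ≤ D) (hτ : Function.Injective τ)
    (hτ0 : ∀ a, τ a ≠ 0) (hC : C.IsOver B2)
    (hwrong : 3 * ((D + 1) * ((M + 1) * #(wrong C f))) ≤ 2 ^ (k * (M + 1))) :
    CktSize B2 (fun (u : Fin (k * η) → Bool) (_ : Unit) => f (rows k η u))
      (27 * (2 * (k * η) + 2) ^ 2 * (trialSize k M D C.size + 3)) := by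
  classical
  set j := Nat.log 2 (k * η) + 1 with hj
  have hF := cktSize_corr C τ hC (k := k) (η := η)
  have hK := cktSize_recMaj hF (3 + j)
  have herr : ∀ u, 3 * err (corr C τ) (3 + j) u (f (rows k η u)) ≤ (1 / 2) ^ (2 ^ j) := fun u =>
    err_le (corr C τ) u _ (err_corr_le C f τ hη hD hτ hτ0 hwrong u) j
  obtain ⟨ω, hω⟩ : ∃ ω : (Fin (3 + j) → Fin 3) → ZIdx k M → Bool,
      ∀ u, ω ∉ wrongSet (corr C τ) (3 + j) u (f (rows k η u)) :=
    exists_forall_notMem_of_small (fun u => wrongSet (corr C τ) (3 + j) u (f (rows k η u)))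
      (Nat.lt_pow_succ_log_self one_lt_two (k * η)).le fun u => herr u
  have hωc : ∀ u, recMaj (corr C τ) (3 + j) u ω = f (rows k η u) := fun u => by
    simpa [wrongSet] using hω u
  have hW := hK.hardwire fun cb : (Fin (3 + j) → Fin 3) × ZIdx k M => ω cb.1 cb.2
  refine (hW.of_le ?_).congr fun u _ => hωc u
  have h3 := three_pow_log_succ_le (k * η)
  have hsize : recMajSize (0 + 1 + trialSize k M D C.size) (3 + j) + 2 =
      3 ^ 3 * 3 ^ j * (trialSize k M D C.size + 3) := by
    rw [recMajSize_add_two, pow_add]; ring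
  rw [hsize]
  have : 3 ^ 3 * 3 ^ j * (trialSize k M D C.size + 3) ≤ 27 * (2 * (k * η) + 2) ^ 2 * (trialSize k M D C.size + 3) := by
    gcongr
    norm_num
  exact this

end Assembly

end SelfCorrect

end Literature.Computability.Complexity

end
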